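import Literature.AlgebraicGeometry.Motives.ProjectiveSpaceCells
import Literature.AlgebraicGeometry.Motives.LinesInProjectiveSpace
import Literature.AlgebraicGeometry.Motives.ChowLocalizationProofs
import Literature.AlgebraicGeometry.Motives.VarietiesProperProofs
import Literature.AlgebraicGeometry.Motives.VarietiesGeometricallyIntegralProofs
import HarnessLib

/-!
# `CH_j(ℙⁿ_k)` is generated by the class of a `j`-plane; `CH₁(ℙⁿ_k) = ℤ · [line]`

Fulton, *Intersection Theory*, Example 1.9.3 (a): "`A_k(ℙⁿ)` is generated by `[Lᵏ]`, `Lᵏ` a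
`k`-dimensional linear subspace", by the cellular decomposition `Lᵏ - Lᵏ⁻¹ ≅ 𝔸ᵏ`
(Example 1.9.1) and `A_k(𝔸ⁿ) = 0` for `k < n` (§1.9). We prove the generation statement for every
`k = j ≤ n` (the case `j = 1` enters Tian–Zong's theorem `TianZong2014_chowOne_generatedByLines`,
which for a linear `X ≅ ℙⁿ ⊆ ℙⁿ⁺ᶜ` is exactly this statement):

* `exists_isRationallyEquivalent_zsmul_of_range_eq_coordSubspace` — the induction over the flag
  of coordinate subspaces `Λⱼ ⊂ Λⱼ₊₁ ⊂ ⋯ ⊂ Λₙ = ℙⁿ` (`Λₘ = V₊(x_{m+1}, …, xₙ)`): for an integral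
  scheme `Y` closed-immersed onto `Λₘ` (`m ≥ j`), every `j`-cycle on `Y` is rationally equivalent
  ON `Y` to an integer multiple of the prime cycle of the point of `Y` over the generic point of
  `Λⱼ`. Step: the open part of `Y` over `D₊(xₘ)` is the cell `≅ 𝔸ᵐ`
  (`Motives/ProjectiveSpaceCells`), where `A_j = 0` for `m > j` (`Motives/AffineSpaceChow`); the
  localisation sequence (Fulton Prop. 1.8, the tree's `Fulton1998_localizationSequence_holds`)
  moves the cycle into `Y ∖ D₊(xₘ) = Λ_{m-1}`, i.e. onto the integral closed subscheme
  `closure {y_{m-1}}` of `Y`, where the induction hypothesis applies, and proper push-forward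
  (Fulton Thm. 1.4, the tree's `map_mem_ratTrivial_holds`) brings the relation back to `Y`.
* `exists_isRationallyEquivalent_zsmul_coordGenericPoint`, `ChowGroup.exists_eq_zsmul_coordGenericPoint`
  — **`CH_j(ℙⁿ_k) = ℤ · [Λⱼ]` for `j ≤ n`** (generation; that `[Λⱼ]` has infinite order is the
  degree / freeness half, not treated here); `exists_isRationallyEquivalent_zsmul_line`,
  `ChowGroup.exists_eq_zsmul_line` — the case `j = 1`, `ℓ₀` the line `x₂ = ⋯ = xₙ = 0`.

Everything is proved; no named facts.

## References

* W. Fulton, *Intersection Theory*, 2nd ed. (1998), §1.9, Examples 1.9.1, 1.9.3, Prop. 1.8,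
  Thm. 1.4. [Fulton1998]
* R. Hartshorne, *Algebraic Geometry*, I Ex. 2.11 (linear subspaces). [Hartshorne1977]
-/

noncomputable section

open CategoryTheory AlgebraicGeometry Order TopologicalSpace

universe u

namespace Literature.AlgebraicGeometry.Motives

namespace ProjectiveSpaceCells

open MvPolynomial

variable (k : Type u) [Field k] (n : ℕ)

attribute [local instance] MvPolynomial.gradedAlgebra

local notation "𝓐" => MvPolynomial.homogeneousSubmodule (Fin (n + 1)) k

/-! ### The coordinate subspaces `Λₘ` and their generic points -/

/-- The `n - m` coordinate forms `x_{m+1}, …, xₙ` cutting out `Λₘ`. [folklore] -/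
def coordForms (m : ℕ) : Fin (n - m) → MvPolynomial (Fin (n + 1)) k :=
  fun j ↦ MvPolynomial.X ⟨m + 1 + j, by omega⟩

/-- The coordinate forms are linearly independent. [folklore] -/
theorem linearIndependent_coordForms (m : ℕ) : LinearIndependent k (coordForms k n m) := by
  refine (MvPolynomial.linearIndependent_X (Fin (n + 1)) k).comp
    (fun j : Fin (n - m) ↦ (⟨m + 1 + j, by omega⟩ : Fin (n + 1))) ?_
  intro a b hab
  have h : m + 1 + (a : ℕ) = m + 1 + (b : ℕ) := congrArg Fin.val hab
  exact Fin.ext (by omega)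

/-- The coordinate forms are linear. [folklore] -/
theorem isHomogeneous_coordForms (m : ℕ) (j : Fin (n - m)) : (coordForms k n m j).IsHomogeneous 1 :=
  MvPolynomial.isHomogeneous_X k _

/-- The coordinate forms are the variables of index `> m`. [folklore] -/
theorem range_coordForms (m : ℕ) : Set.range (coordForms k n m) =
    (fun j ↦ (MvPolynomial.X j : MvPolynomial (Fin (n + 1)) k)) '' {j : Fin (n + 1) | m < (j : ℕ)} := by
  ext f
  simp only [Set.mem_range, coordForms, Set.mem_image, Set.mem_setOf_eq]
  constructor
  · rintro ⟨j, rfl⟩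
    exact ⟨⟨m + 1 + j, by omega⟩, by simp; omega, rfl⟩
  · rintro ⟨j, hj, rfl⟩
    exact ⟨⟨j - (m + 1), by omega⟩, by congr 1; exact Fin.ext (by simp; omega)⟩

/-- `Λₘ = V₊(coordinate forms)`. [folklore] -/
theorem coordSubspace_eq_zeroLocus_range (m : ℕ) :
    coordSubspace k n m = ProjectiveSpectrum.zeroLocus 𝓐 (Set.range (coordForms k n m)) := by
  rw [range_coordForms]; rfl

variable {n} in
/-- **The generic point `λₘ` of `Λₘ`** (`Motives/LinesInProjectiveSpace.linearSubspacePoint` for the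
coordinate forms). [cite: Hartshorne1977, I Ex. 2.11] -/
def coordGenericPoint (m : ℕ) : ↥(Proj 𝓐) :=
  linearSubspacePoint (coordForms k n m) (linearIndependent_coordForms k n m)
    (isHomogeneous_coordForms k n m) (Nat.sub_le n m)

variable {n} in
/-- `closure {λₘ} = Λₘ`. [cite: Hartshorne1977, I Ex. 2.11] -/
theorem closure_coordGenericPoint (m : ℕ) :
    closure {coordGenericPoint k (n := n) m} = coordSubspace k n m := by
  rw [coordSubspace_eq_zeroLocus_range]
  exact closure_linearSubspacePoint (coordForms k n m) (linearIndependent_coordForms k n m)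
    (isHomogeneous_coordForms k n m) (Nat.sub_le n m)

variable {n} in
/-- `λₘ ∈ Λₘ`. [folklore] -/
theorem coordGenericPoint_mem (m : ℕ) : coordGenericPoint k (n := n) m ∈ coordSubspace k n m := by
  rw [← closure_coordGenericPoint]
  exact subset_closure rfl

/-- `Λₘ ⊆ Λₘ'` for `m ≤ m'`. [folklore] -/
theorem coordSubspace_mono {m m' : ℕ} (h : m ≤ m') : coordSubspace k n m ⊆ coordSubspace k n m' := by
  refine ProjectiveSpectrum.zeroLocus_anti_mono 𝓐 (Set.image_mono fun j hj ↦ ?_)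
  simp only [Set.mem_setOf_eq] at hj ⊢
  omega

variable {n} in
/-- `dim Λₘ = m` (`m ≤ n`): the generic point has height `m`. [cite: Hartshorne1977, I Ex. 2.11] -/
theorem height_coordGenericPoint {m : ℕ} (hm : m ≤ n) :
    height (coordGenericPoint k (n := n) m) = (m : ℕ∞) := by
  have h := height_linearSubspacePoint (coordForms k n m) (linearIndependent_coordForms k n m)
    (isHomogeneous_coordForms k n m) (Nat.sub_le n m)
  rw [Nat.sub_sub_self hm] at h
  exact h

variable {n} in
/-- The other points of `Λₘ` have dimension `< m`. [cite: Hartshorne1977, I Ex. 2.11] -/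
theorem height_lt_of_mem_coordSubspace {m : ℕ} (hm : m ≤ n) {z : ↥(Proj 𝓐)}
    (hz : z ∈ coordSubspace k n m) (hne : z ≠ coordGenericPoint k m) : height z < (m : ℕ∞) := by
  have h := height_lt_of_mem_zeroLocus (coordForms k n m) (linearIndependent_coordForms k n m)
    (isHomogeneous_coordForms k n m) (Nat.sub_le n m) (z := z)
    (by rw [← coordSubspace_eq_zeroLocus_range]; exact hz) hne
  rw [Nat.sub_sub_self hm] at h
  exact h

variable {n} in
/-- A point of `Λₘ` of dimension `m` is its generic point. [folklore] -/
theorem eq_coordGenericPoint_of_height_eq {m : ℕ} (hm : m ≤ n) {z : ↥(Proj 𝓐)}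
    (hz : z ∈ coordSubspace k n m) (hh : height z = (m : ℕ∞)) : z = coordGenericPoint k m := by
  by_contra hne
  exact (lt_irrefl _) (hh ▸ height_lt_of_mem_coordSubspace k hm hz hne)

/-- `Λ_{m+1} ∩ V₊(x_{m+1}) ⊆ Λₘ`: a point of `Λ_{m+1}` outside `D₊(x_{m+1})` lies on `Λₘ`.
[folklore] -/
theorem mem_coordSubspace_of_notMem_basicOpen {m : ℕ} (hm : m + 1 < n + 1)
    {z : ↥(Proj 𝓐)} (hz : z ∈ coordSubspace k n (m + 1))
    (hx : z ∉ Proj.basicOpen 𝓐 (MvPolynomial.X (⟨m + 1, hm⟩ : Fin (n + 1)))) :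
    z ∈ coordSubspace k n m := by
  change (fun j ↦ (MvPolynomial.X j : MvPolynomial (Fin (n + 1)) k)) '' {j : Fin (n + 1) | m + 1 < (j : ℕ)} ⊆
    ((z : ProjectiveSpectrum 𝓐).asHomogeneousIdeal : Set (MvPolynomial (Fin (n + 1)) k)) at hz
  change (fun j ↦ (MvPolynomial.X j : MvPolynomial (Fin (n + 1)) k)) '' {j : Fin (n + 1) | m < (j : ℕ)} ⊆
    ((z : ProjectiveSpectrum 𝓐).asHomogeneousIdeal : Set (MvPolynomial (Fin (n + 1)) k))
  rintro f ⟨j, hj, rfl⟩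
  simp only [Set.mem_setOf_eq] at hj
  by_cases hjm : (j : ℕ) = m + 1
  · have hj' : j = ⟨m + 1, hm⟩ := Fin.ext hjm
    subst hj'
    by_contra hmem
    exact hx hmem
  · exact hz ⟨j, by simp only [Set.mem_setOf_eq]; omega, rfl⟩

/-- `Λₙ = ℙⁿ`. [folklore] -/
theorem coordSubspace_self : coordSubspace k n n = Set.univ := by
  have h : {j : Fin (n + 1) | n < (j : ℕ)} = ∅ := by
    ext j; simp only [Set.mem_setOf_eq, Set.mem_empty_iff_false, iff_false, not_lt]; omega
  rw [coordSubspace, h, Set.image_empty]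
  exact ProjectiveSpectrum.zeroLocus_empty 𝓐

/-! ### The induction over the flag `Λ₁ ⊂ Λ₂ ⊂ ⋯` -/

variable {n}

/-- Push-forward along a closed immersion as an additive map (for `map_sub`, `map_zsmul`).
[folklore] -/
private def mapHom {W X : Scheme.{u}} (ι : W ⟶ X) [IsClosedImmersion ι] :
    AlgebraicCycle W ℤ →+ AlgebraicCycle X ℤ :=
  AddMonoidHom.mk' (AlgebraicCycle.map ι height height) (algebraicCycleMap_add ι height height)

/-- **Base of the induction**: on an integral scheme closed-immersed onto `Λⱼ`, every `j`-cycle is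
a multiple of the prime cycle of the point over `λⱼ` (the only point of dimension `j`).
[cite: Fulton1998, Example 1.9.3] -/
theorem eq_zsmul_primeCycle_of_range_eq_coordSubspace {j : ℕ} (hj : j ≤ n) {Y : Scheme.{u}}
    (e : Y ⟶ Proj 𝓐) [IsClosedImmersion e]
    (hrange : Set.range e.base = coordSubspace k n j) {c : AlgebraicCycle Y ℤ}
    (hc : c ∈ cyclesOfDim Y j) {y : Y} (hy : e.base y = coordGenericPoint k j) :
    c = c y • primeCycle y := by
  ext z
  by_cases hz : z = y
  · subst hz
    simp [primeCycle_apply_self]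
  · have hcz : c z = 0 := by
      by_contra h
      have hh : height (e.base z) = (j : ℕ∞) := by
        rw [height_base_eq_of_isClosedImmersion' e z]; exact hc z h
      have hmem : e.base z ∈ coordSubspace k n j := hrange ▸ ⟨z, rfl⟩
      exact hz (e.isClosedEmbedding.injective
        ((eq_coordGenericPoint_of_height_eq k hj hmem hh).trans hy.symm))
    simp [hcz, primeCycle_apply_of_ne hz]

/-- **`CH_j` along the flag of coordinate subspaces** (Fulton Examples 1.9.1, 1.9.3): for an
integral scheme `Y` and a closed immersion `e : Y ↪ ℙⁿ_k` with image `Λ_{m+j} = V₊(x_{m+j+1}, …, xₙ)`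
(`m + j ≤ n`), every `j`-cycle on `Y` is rationally equivalent on `Y` to an integer multiple of the
prime cycle of the point of `Y` over the generic point `λⱼ` of `Λⱼ`. Induction on `m`: the open
part of `Y` over `D₊(x_{m+j})` is a cell `≅ 𝔸^{m+j}` where `A_j = 0` (`m ≥ 1`), the localisation
sequence moves the cycle onto `closure {y} ≅ Λ_{m+j-1}`, and proper push-forward along
`closure {y} ↪ Y` returns the relation. [cite: Fulton1998, Examples 1.9.1 and 1.9.3] -/
theorem exists_isRationallyEquivalent_zsmul_of_range_eq_coordSubspace (j : ℕ) :
    ∀ (m : ℕ), m + j ≤ n → ∀ {Y : Scheme.{u}} [IsIntegral Y]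
      (e : Y ⟶ Proj 𝓐) [IsClosedImmersion e],
      Set.range e.base = coordSubspace k n (m + j) →
      ∀ c ∈ cyclesOfDim Y j, ∃ (y : Y) (a : ℤ), e.base y = coordGenericPoint k j ∧
        IsRationallyEquivalent c (a • primeCycle y) j := by
  intro m
  induction m with
  | zero =>
    intro hn Y _ e _ hrange c hc
    rw [zero_add] at hrange hn
    obtain ⟨y, hy⟩ : ∃ y, e.base y = coordGenericPoint k j := by
      have h := coordGenericPoint_mem k (n := n) j
      rw [← hrange] at h
      exact h
    exact ⟨y, c y, hy, by
      rw [← eq_zsmul_primeCycle_of_range_eq_coordSubspace k hn e hrange hc hy]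
      exact IsRationallyEquivalent.refl _⟩
  | succ m ih =>
    intro hmn Y _ e _ hrange c hc
    rw [show m + 1 + j = m + j + 1 by omega] at hrange
    haveI : IsProper (projectiveSpace n k).hom := isProper_projectiveSpace n k
    -- `Y` over `k`
    let e' : Y ⟶ (projectiveSpace n k).left := e
    haveI : IsClosedImmersion e' := ‹IsClosedImmersion e›
    let f : Y ⟶ Spec (CommRingCat.of k) := e' ≫ (projectiveSpace n k).hom
    haveI hf₁ : LocallyOfFiniteType f := inferInstance
    haveI hf₂ : QuasiCompact f := inferInstance
    let YO : SchemeOver k := Over.mk f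
    haveI : LocallyOfFiniteType YO.hom := hf₁
    haveI : QuasiCompact YO.hom := hf₂
    have hm2 : m + j + 1 < n + 1 := by omega
    -- the cell `U = e⁻¹ D₊(x_{m+j+1}) ≅ 𝔸^{m+j+1}`, where `A_j = 0`
    let U : Y.Opens := e ⁻¹ᵁ Proj.basicOpen 𝓐 (MvPolynomial.X (⟨m + j + 1, hm2⟩ : Fin (n + 1)))
    have hU : cyclesOfDim (U : Scheme.{u}) j ≤ ratTrivial (U : Scheme.{u}) j :=
      cyclesOfDim_preimage_basicOpen_le_ratTrivial k e hm2 hrange (by omega)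
    have hres : flatPullback U.ι locallyFinsupp_flatPullbackFun_holds c ∈
        ratTrivial (U : Scheme.{u}) j := by
      refine hU (fun u hu ↦ ?_)
      rw [flatPullback_ι_apply] at hu
      calc height u = height (U.ι.base u) := (height_opens_ι_base YO U u).symm
        _ = _ := hc _ hu
    -- localisation sequence: move `c` off `U`
    obtain ⟨c', hc', hsupp, hcc'⟩ := Fulton1998_localizationSequence_holds YO U
      locallyFinsupp_flatPullbackFun_holds j c hc hres
    have hc'supp : ∀ z, c' z ≠ 0 → e.base z ∈ coordSubspace k n (m + j) := fun z hz ↦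
      mem_coordSubspace_of_notMem_basicOpen k n hm2 (hrange ▸ ⟨z, rfl⟩) (hsupp z hz)
    -- the integral closed subscheme `Y' = closure {y₁}`, `y₁` over `λ_{m+j}`
    obtain ⟨y₁, hy₁⟩ : ∃ y₁, e.base y₁ = coordGenericPoint k (m + j) := by
      have h : coordGenericPoint k (m + j) ∈ Set.range e.base := by
        rw [hrange]
        exact coordSubspace_mono k n (by omega) (coordGenericPoint_mem k (n := n) (m + j))
      exact h
    let Y' := ClosedSubvariety.ofPoint Y y₁
    have hrange' : Set.range (Y'.ι ≫ e).base = coordSubspace k n (m + j) := by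
      rw [Scheme.Hom.comp_base, TopCat.coe_comp, Set.range_comp, ClosedSubvariety.range_ofPoint_ι,
        ← e.isClosedEmbedding.closure_image_eq, Set.image_singleton, hy₁,
        closure_coordGenericPoint]
    have hc'van : ∀ z ∉ Set.range Y'.ι.base, c' z = 0 := by
      intro z hz
      by_contra h
      apply hz
      rw [ClosedSubvariety.range_ofPoint_ι]
      have hmem : e.base z ∈ e.base '' closure {y₁} := by
        rw [← e.isClosedEmbedding.closure_image_eq, Set.image_singleton, hy₁,
          closure_coordGenericPoint]
        exact hc'supp z h
      obtain ⟨z', hz', hzz'⟩ := hmem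
      rwa [← e.isClosedEmbedding.injective hzz']
    let c'' : AlgebraicCycle Y'.carrier ℤ :=
      algebraicCycleComap Y'.ι Y'.ι.isClosedEmbedding.injective c'
    have hc'' : c'' ∈ cyclesOfDim Y'.carrier j := algebraicCycleComap_mem_cyclesOfDim Y'.ι hc'
    have hmap : AlgebraicCycle.map Y'.ι height height c'' = c' :=
      algebraicCycleMap_comap Y'.ι c' hc'van
    -- induction hypothesis on `Y'`
    haveI : IsIntegral Y'.carrier := Y'.isIntegral
    obtain ⟨y', a, hy', hrat'⟩ := ih (by omega) (Y'.ι ≫ e) hrange' c'' hc''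
    -- push forward along `Y' ↪ Y` over `k`
    let Y'O : SchemeOver k := Over.mk (Y'.ι ≫ f)
    let ιO : Y'O ⟶ YO := Over.homMk Y'.ι rfl
    haveI : LocallyOfFiniteType Y'O.hom := inferInstanceAs (LocallyOfFiniteType (Y'.ι ≫ f))
    haveI : IsProper ιO.left := inferInstanceAs (IsProper Y'.ι)
    have hpush := map_mem_ratTrivial_holds j ιO hrat'
    change mapHom Y'.ι (c'' - a • primeCycle y') ∈ ratTrivial Y j at hpush
    rw [map_sub, map_zsmul] at hpush
    change AlgebraicCycle.map Y'.ι height height c'' -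
      a • AlgebraicCycle.map Y'.ι height height (primeCycle y') ∈ ratTrivial Y j at hpush
    rw [hmap, algebraicCycleMap_primeCycle] at hpush
    exact ⟨Y'.ι.base y', a, hy', hcc'.trans hpush⟩

/-- **Every `j`-cycle on `ℙⁿ_k` (`j ≤ n`) is rationally equivalent to an integer multiple of the
coordinate `j`-plane `Λⱼ = V₊(x_{j+1}, …, xₙ)`** (Fulton Example 1.9.3 (a): "`A_k(ℙⁿ)` is generated
by `[Lᵏ]`"). [cite: Fulton1998, Example 1.9.3] -/
theorem exists_isRationallyEquivalent_zsmul_coordGenericPoint {j : ℕ} (hj : j ≤ n)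
    (c : AlgebraicCycle (projectiveSpace n k).left ℤ)
    (hc : c ∈ cyclesOfDim (projectiveSpace n k).left j) :
    ∃ a : ℤ, IsRationallyEquivalent c (a • primeCycle (coordGenericPoint k (n := n) j)) j := by
  haveI : IsIntegral (Proj 𝓐) :=
    IsSmoothProjective.isIntegral_holds (isSmoothProjective_projectiveSpace_holds k n)
  have hrange : Set.range (𝟙 (Proj 𝓐)).base = coordSubspace k n (n - j + j) := by
    rw [Nat.sub_add_cancel hj, coordSubspace_self, Scheme.Hom.id_base]
    exact Set.range_id
  obtain ⟨y, a, hy, hrat⟩ := exists_isRationallyEquivalent_zsmul_of_range_eq_coordSubspace k j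
    (n - j) (by omega) (𝟙 _) hrange c hc
  refine ⟨a, ?_⟩
  have hy' : y = coordGenericPoint k (n := n) j := hy
  rwa [hy'] at hrat

/-- **`CH_j(ℙⁿ_k) = ℤ · [Λⱼ]`** (generation half of Fulton Example 1.9.3 (a)): every class in
`CH_j(ℙⁿ_k)`, `j ≤ n`, is an integer multiple of the class of the coordinate `j`-plane.
[cite: Fulton1998, Example 1.9.3] -/
theorem ChowGroup.exists_eq_zsmul_coordGenericPoint {j : ℕ} (hj : j ≤ n)
    (x : ChowGroup (projectiveSpace n k).left j) :
    ∃ a : ℤ, x = a • ChowGroup.ofPoint (coordGenericPoint k (n := n) j)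
      (height_coordGenericPoint k hj) := by
  induction x using ChowGroup.induction_on with
  | h c =>
    obtain ⟨a, ha⟩ := exists_isRationallyEquivalent_zsmul_coordGenericPoint k hj c c.2
    refine ⟨a, ?_⟩
    rw [ChowGroup.ofPoint, ← map_zsmul]
    exact ChowGroup.mk_eq_mk_iff.mpr ha

/-- The line `ℓ₀ = V₊(x₂, …, xₙ) ⊆ ℙⁿ_k` (its generic point). [folklore] -/
def lineGenericPoint : ↥(Proj 𝓐) := coordGenericPoint k (n := n) 1

/-- `ℓ₀` has dimension one (`n ≥ 1`). [cite: Hartshorne1977, I Ex. 2.11] -/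
theorem height_lineGenericPoint (hn : 1 ≤ n) : height (lineGenericPoint k (n := n)) = 1 := by
  rw [lineGenericPoint, height_coordGenericPoint k hn, Nat.cast_one]

/-- **Every `1`-cycle on `ℙⁿ_k` (`n ≥ 1`) is rationally equivalent to an integer multiple of the
line `ℓ₀`** (Fulton Example 1.9.3 (a), `k = 1`). [cite: Fulton1998, Example 1.9.3] -/
theorem exists_isRationallyEquivalent_zsmul_line (hn : 1 ≤ n)
    (c : AlgebraicCycle (projectiveSpace n k).left ℤ)
    (hc : c ∈ cyclesOfDim (projectiveSpace n k).left 1) :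
    ∃ a : ℤ, IsRationallyEquivalent c (a • primeCycle (lineGenericPoint k (n := n))) 1 :=
  exists_isRationallyEquivalent_zsmul_coordGenericPoint k hn c hc

/-- **`CH₁(ℙⁿ_k) = ℤ · [ℓ₀]`** (generation): every class in `CH₁(ℙⁿ_k)` is an integer multiple of
the class of the line `x₂ = ⋯ = xₙ = 0` (Fulton Example 1.9.3 (a)). [cite: Fulton1998, Example 1.9.3] -/
theorem ChowGroup.exists_eq_zsmul_line (hn : 1 ≤ n) (x : ChowGroup (projectiveSpace n k).left 1) :
    ∃ a : ℤ, x = a • ChowGroup.ofPoint (lineGenericPoint k (n := n)) (height_lineGenericPoint k hn) :=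
  ChowGroup.exists_eq_zsmul_coordGenericPoint k hn x

end ProjectiveSpaceCells

end Literature.AlgebraicGeometry.Motives
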